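import Literature.Analysis.FluidPDE.PassiveScalarForcedGradientGrowth
import Literature.Analysis.FluidPDE.TorusLinearisedNSVorticity
import Literature.Analysis.FunctionSpaces.TorusLerayHelmholtzH1
import Literature.Analysis.FunctionSpaces.TorusMollifierEstimates
import HarnessLib

/-!
# Shear-nilpotent `H¹`/`H²` growth of a forced passive scalar along a shear drift — the five bounds
(route `AnomalousDissipation/SawtoothPulseCascade`, line `lip-agmon` of the crux ApproxSol58 =
stmt-AnomalousDissipation-19688; lead g4, module E-abstract, part 1)

For a classical solution `θ` of `∂ₜθ + u·∇θ = κΔθ + s` on `[a, b] × T^d` (`κ ≥ 0`; the tree's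
`Torus.IsClassicalScalarTransportForcedOn`) whose drift has the SHEAR STRUCTURE of one half pulse of
the sawtooth cascade — `∂ₖu = 0` (no dependence on the streamwise coordinate `xₖ`) and the cross
derivatives `∂ₖ'u`, `∂ₖ'∂ₖ'u` pair with gradients only through the streamwise component, with rates
`|⟪∂ₖ'u, w⟫| ≤ α(t)|wₖ|`, `|⟪∂ₖ'∂ₖ'u, w⟫| ≤ β(t)|wₖ|` — the `L²` sizes of `∂ₖθ, ∂ₖ'θ, ∂ₖ∂ₖθ, ∂ₖ∂ₖ'θ,
∂ₖ'∂ₖ'θ` obey a TRIANGULAR (nilpotent) system: `xₖ`-derivatives see no shear term, each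
`xₖ'`-derivative converts into an `xₖ`-derivative at rate `α` (commutator `−⟪∂ₖ'u, ∇·⟫`), the second
cross derivative also sees `β` and the factor `2`. Uniform in `κ ≥ 0` (dissipation dropped). Contrast
the tree's generic `IsClassicalScalarTransportForcedOn.sqrt_scalarGradNormSq_le_exp` (`e^{dΛ(t−a)}`,
Grönwall): for the cascade pulses `Λ(b − a) ≍ γ`, and a factor `e^{cγ}` per half pulse would destroy
the per-phase bookkeeping of the line, while the polynomial growth proved here does not.

Tools: `IsClassicalScalarTransportForcedOn.partialDeriv` (the differentiated equation, source
`∂ᵢs − ⟪∂ᵢu, ∇θ⟫`) and `.sqrt_integral_sq_le` (`‖θ(t)‖₂ ≤ ‖θ(a)‖₂ + ∫ G`), both from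
`PassiveScalarForcedGradientGrowth`. The slot summary (unipotent matrices) is in the sequel
`…LipAgmonShearSlot`.
-/

set_option linter.dupNamespace false

noncomputable section

namespace Summit.AnomalousDissipation.AnomalousDissipation.Theorems.SawtoothPulseCascade.LipAgmon

open Set MeasureTheory intervalIntegral
open scoped InnerProductSpace ContDiff
open Literature.Analysis Literature.Analysis.FunctionSpaces Literature.Analysis.FluidPDE
open Literature.Analysis.FunctionSpaces.Torus

/-! ## §1 `L²` algebra for continuous functions on the torus -/

section L2

variable {d : Type*} [Fintype d]

/-- `‖f − g‖_{L²} ≤ ‖f‖_{L²} + ‖g‖_{L²}` (continuous `f`, `g`). [folklore] -/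
theorem sqrt_integral_sub_sq_le' {f g : UnitAddTorus d → ℝ} (hf : Continuous f) (hg : Continuous g) :
    Real.sqrt (∫ x, (f x - g x) ^ 2) ≤ Real.sqrt (∫ x, f x ^ 2) + Real.sqrt (∫ x, g x ^ 2) := by
  have hg' : Continuous fun x => -g x := hg.neg
  have h := Torus.sqrt_integral_add_sq_le hf hg'
  have e1 : (∫ x, (f x - g x) ^ 2) = ∫ x, (f x + -g x) ^ 2 := by
    congr 1
  have e2 : (∫ x, (-g x) ^ 2) = ∫ x, g x ^ 2 := by
    congr 1; funext x; ring
  rw [e1, ← e2]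
  exact h

/-- `‖f‖_{L²} ≤ M ‖g‖_{L²}` when `|f| ≤ M|g|` pointwise (`M ≥ 0`, continuous `f`, `g`). [folklore] -/
theorem sqrt_integral_sq_le_mul {f g : UnitAddTorus d → ℝ} (hf : Continuous f) (hg : Continuous g)
    {M : ℝ} (hM : 0 ≤ M) (hle : ∀ x, |f x| ≤ M * |g x|) :
    Real.sqrt (∫ x, f x ^ 2) ≤ M * Real.sqrt (∫ x, g x ^ 2) := by
  have i1 : Integrable (fun x => f x ^ 2) volume := (hf.pow 2).integrable_unitAddTorus
  have i2 : Integrable (fun x => M ^ 2 * g x ^ 2) volume :=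
    (continuous_const.mul (hg.pow 2)).integrable_unitAddTorus
  have hle' : ∫ x, f x ^ 2 ≤ ∫ x, M ^ 2 * g x ^ 2 := by
    refine integral_mono i1 i2 fun x => ?_
    have h1 := hle x
    have h2 : 0 ≤ M * |g x| := mul_nonneg hM (abs_nonneg _)
    calc f x ^ 2 = |f x| ^ 2 := (sq_abs _).symm
      _ ≤ (M * |g x|) ^ 2 := pow_le_pow_left₀ (abs_nonneg _) h1 2
      _ = M ^ 2 * g x ^ 2 := by rw [mul_pow, sq_abs]
  calc Real.sqrt (∫ x, f x ^ 2) ≤ Real.sqrt (∫ x, M ^ 2 * g x ^ 2) := Real.sqrt_le_sqrt hle'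
    _ = M * Real.sqrt (∫ x, g x ^ 2) := by
        rw [MeasureTheory.integral_const_mul, Real.sqrt_mul (sq_nonneg _), Real.sqrt_sq hM]

/-- `‖f − g − h‖_{L²} ≤ ‖f‖_{L²} + ‖g‖_{L²} + ‖h‖_{L²}` (continuous). [folklore] -/
theorem sqrt_integral_sub_sub_sq_le {f g h : UnitAddTorus d → ℝ} (hf : Continuous f) (hg : Continuous g)
    (hh : Continuous h) :
    Real.sqrt (∫ x, (f x - g x - h x) ^ 2) ≤
      Real.sqrt (∫ x, f x ^ 2) + Real.sqrt (∫ x, g x ^ 2) + Real.sqrt (∫ x, h x ^ 2) := by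
  have hfg : Continuous fun x => f x - g x := hf.sub hg
  have h1 := sqrt_integral_sub_sq_le' (f := fun x => f x - g x) (g := h) hfg hh
  have h2 := sqrt_integral_sub_sq_le' hf hg
  linarith

end L2


/-! ## §2 The differentiated sources along a shear drift -/

section Shear

variable {d : Type*} [Fintype d] [DecidableEq d]
variable {a b κ : ℝ} {u : ℝ → UnitAddTorus d → EuclideanSpace ℝ d} {s θ : ℝ → UnitAddTorus d → ℝ}

/-- The second-order source, expanded pointwise: for smooth `φ`, `ψ`, `v`,
`∂ᵢ(∂ₖψ − ⟪∂ₖv, ∇φ⟫) = ∂ᵢ∂ₖψ − ⟪∂ₖv, ∇∂ᵢφ⟫ − ⟪∂ᵢ∂ₖv, ∇φ⟫`. [folklore] -/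
theorem partialDeriv_source_expand {φ ψ : UnitAddTorus d → ℝ} {v : UnitAddTorus d → EuclideanSpace ℝ d}
    (hφ : IsSmooth φ) (hψ : IsSmooth ψ) (hv : IsSmooth v) (i k : d) (x : UnitAddTorus d) :
    Torus.partialDeriv i (fun y => Torus.partialDeriv k ψ y -
        ⟪Torus.partialDeriv k v y, Torus.gradient φ y⟫_ℝ) x =
      Torus.partialDeriv i (Torus.partialDeriv k ψ) x -
        (⟪Torus.partialDeriv k v x, Torus.gradient (Torus.partialDeriv i φ) x⟫_ℝ +
          ⟪Torus.partialDeriv i (Torus.partialDeriv k v) x, Torus.gradient φ x⟫_ℝ) := by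
  -- adapted from the private lemma of `PassiveScalarForcedGradientGrowth`
  have hf : IsContDiff 1 (Torus.partialDeriv k ψ) := (hψ.partialDeriv k).isContDiff (by simp)
  have hg : IsContDiff 1 (fun y => ⟪Torus.partialDeriv k v y, Torus.gradient φ y⟫_ℝ) :=
    ((hv.partialDeriv k).inner hφ.gradient).isContDiff (by simp)
  have e : (fun y => Torus.partialDeriv k ψ y - ⟪Torus.partialDeriv k v y, Torus.gradient φ y⟫_ℝ) =
      Torus.partialDeriv k ψ - fun y => ⟪Torus.partialDeriv k v y, Torus.gradient φ y⟫_ℝ := rfl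
  rw [e, Torus.partialDeriv_sub hf hg, Pi.sub_apply,
    Torus.partialDeriv_inner ((hv.partialDeriv k).isContDiff (by simp)) (hφ.gradient.isContDiff (by simp)),
    Torus.partialDeriv_gradient_comm hφ]

/-- Along a drift with `∂ₖu = 0`, the source of the `∂ₖ`-equation is `∂ₖs` (no commutator). [folklore] -/
theorem source_stream_eq {k : d} {t : ℝ} (hu0 : ∀ x, Torus.partialDeriv k (u t) x = 0) (x : UnitAddTorus d) :
    Torus.partialDeriv k (s t) x - ⟪Torus.partialDeriv k (u t) x, Torus.gradient (θ t) x⟫_ℝ =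
      Torus.partialDeriv k (s t) x := by
  rw [hu0 x, inner_zero_left, sub_zero]

/-- `⟪∂ₖ'u, ∇ψ⟫` is controlled by the streamwise derivative: `|⟪∂ₖ'u, ∇ψ⟫| ≤ α |∂ₖψ|` when
`|⟪∂ₖ'u(x), w⟫| ≤ α |wₖ|` for all `w`. [folklore] -/
theorem abs_inner_gradient_le_of_shear {v : UnitAddTorus d → EuclideanSpace ℝ d} {ψ : UnitAddTorus d → ℝ}
    (hψ : IsSmooth ψ) {α : ℝ} {k : d} (hv : ∀ x (w : EuclideanSpace ℝ d), |⟪v x, w⟫_ℝ| ≤ α * |w k|)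
    (x : UnitAddTorus d) :
    |⟪v x, Torus.gradient ψ x⟫_ℝ| ≤ α * |Torus.partialDeriv k ψ x| := by
  have h := hv x (Torus.gradient ψ x)
  rwa [Torus.gradient_apply (hψ.isContDiff (by simp))] at h

end Shear


/-! ## §3 The five growth bounds (levels 1 and 2) -/

section Growth

variable {d : Type*} [Fintype d] [DecidableEq d]
variable {a b κ : ℝ} {u : ℝ → UnitAddTorus d → EuclideanSpace ℝ d} {s θ : ℝ → UnitAddTorus d → ℝ}
variable {k k' : d} {α β : ℝ → ℝ}

/-- **Level 1, streamwise: no shear term.** Along a drift with `∂ₖu = 0`, if `‖∂ₖs(τ)‖₂ ≤ σ(τ)`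
(`σ ≥ 0` continuous) then `‖∂ₖθ(t)‖₂ ≤ ‖∂ₖθ(a)‖₂ + ∫ₐᵗ σ`, uniformly in `κ ≥ 0`.
[cite: MajdaBertozzi2002, §3.2 Prop. 3.7 (energy estimates for derivatives, uniform in the viscosity)] -/
theorem stream_deriv_le (hab : a < b) (h : Torus.IsClassicalScalarTransportForcedOn (Icc a b) κ u s θ)
    (hκ : 0 ≤ κ) (hu0 : ∀ t ∈ Icc a b, ∀ x, Torus.partialDeriv k (u t) x = 0)
    {σ : ℝ → ℝ} (hσc : ContinuousOn σ (Icc a b)) (hσ0 : ∀ τ ∈ Icc a b, 0 ≤ σ τ)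
    (hσ : ∀ τ ∈ Icc a b, Real.sqrt (∫ x, (Torus.partialDeriv k (s τ) x) ^ 2) ≤ σ τ)
    {t : ℝ} (ht : t ∈ Icc a b) :
    Real.sqrt (∫ x, (Torus.partialDeriv k (θ t) x) ^ 2) ≤
      Real.sqrt (∫ x, (Torus.partialDeriv k (θ a) x) ^ 2) + ∫ τ in a..t, σ τ := by
  have h1 := h.partialDeriv hab k
  refine h1.sqrt_integral_sq_le hκ Subset.rfl hσc hσ0 (fun τ hτ => ?_) ht
  have e : (∫ x, (Torus.partialDeriv k (s τ) x -
      ⟪Torus.partialDeriv k (u τ) x, Torus.gradient (θ τ) x⟫_ℝ) ^ 2) =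
      ∫ x, (Torus.partialDeriv k (s τ) x) ^ 2 := by
    congr 1; funext x; rw [source_stream_eq (hu0 τ hτ)]
  rw [e]
  exact hσ τ hτ

/-- **Level 1, cross-stream: the shear converts `∂ₖθ` into `∂ₖ'θ` at rate `α`.** If
`|⟪∂ₖ'u(τ,x), w⟫| ≤ α(τ)|wₖ|`, `‖∂ₖ's(τ)‖₂ ≤ σ(τ)` and `‖∂ₖθ(τ)‖₂ ≤ B` on the window, then
`‖∂ₖ'θ(t)‖₂ ≤ ‖∂ₖ'θ(a)‖₂ + ∫ₐᵗ (σ + αB)`, uniformly in `κ ≥ 0`.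
[cite: MajdaBertozzi2002, §3.2 Prop. 3.7 (energy estimates for derivatives, uniform in the viscosity)] -/
theorem cross_deriv_le (hab : a < b) (h : Torus.IsClassicalScalarTransportForcedOn (Icc a b) κ u s θ)
    (hκ : 0 ≤ κ)
    (hu1 : ∀ t ∈ Icc a b, ∀ x (w : EuclideanSpace ℝ d), |⟪Torus.partialDeriv k' (u t) x, w⟫_ℝ| ≤ α t * |w k|)
    (hαc : ContinuousOn α (Icc a b)) (hα0 : ∀ τ ∈ Icc a b, 0 ≤ α τ)
    {σ : ℝ → ℝ} (hσc : ContinuousOn σ (Icc a b)) (hσ0 : ∀ τ ∈ Icc a b, 0 ≤ σ τ)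
    (hσ : ∀ τ ∈ Icc a b, Real.sqrt (∫ x, (Torus.partialDeriv k' (s τ) x) ^ 2) ≤ σ τ)
    {B : ℝ} (hB0 : 0 ≤ B)
    (hB : ∀ τ ∈ Icc a b, Real.sqrt (∫ x, (Torus.partialDeriv k (θ τ) x) ^ 2) ≤ B)
    {t : ℝ} (ht : t ∈ Icc a b) :
    Real.sqrt (∫ x, (Torus.partialDeriv k' (θ t) x) ^ 2) ≤
      Real.sqrt (∫ x, (Torus.partialDeriv k' (θ a) x) ^ 2) + ∫ τ in a..t, (σ τ + α τ * B) := by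
  have h1 := h.partialDeriv hab k'
  have hGc : ContinuousOn (fun τ => σ τ + α τ * B) (Icc a b) := hσc.add (hαc.mul continuousOn_const)
  refine h1.sqrt_integral_sq_le hκ Subset.rfl (G := fun τ => σ τ + α τ * B) hGc
    (fun τ hτ => add_nonneg (hσ0 τ hτ) (mul_nonneg (hα0 τ hτ) hB0)) (fun τ hτ => ?_) ht
  show _ ≤ σ τ + α τ * B
  have hsτ : IsSmooth (s τ) := h.smooth_source.isSmooth_slice hτ
  have huτ : IsSmooth (u τ) := h.smooth_velocity.isSmooth_slice hτ
  have hθτ : IsSmooth (θ τ) := h.smooth_scalar.isSmooth_slice hτ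
  have c1 : Continuous (Torus.partialDeriv k' (s τ)) := (hsτ.partialDeriv k').continuous
  have c2 : Continuous fun x => ⟪Torus.partialDeriv k' (u τ) x, Torus.gradient (θ τ) x⟫_ℝ :=
    (huτ.partialDeriv k').continuous.inner hθτ.gradient.continuous
  have c3 : Continuous (Torus.partialDeriv k (θ τ)) := (hθτ.partialDeriv k).continuous
  have i1 := sqrt_integral_sub_sq_le' c1 c2
  have i2 : Real.sqrt (∫ x, ⟪Torus.partialDeriv k' (u τ) x, Torus.gradient (θ τ) x⟫_ℝ ^ 2) ≤
      α τ * Real.sqrt (∫ x, (Torus.partialDeriv k (θ τ) x) ^ 2) :=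
    sqrt_integral_sq_le_mul c2 c3 (hα0 τ hτ) (abs_inner_gradient_le_of_shear hθτ (hu1 τ hτ))
  have i3 := mul_le_mul_of_nonneg_left (hB τ hτ) (hα0 τ hτ)
  linarith [hσ τ hτ]

/-- **Level 2, streamwise–streamwise: no shear term.** Along a drift with `∂ₖu = 0`, if
`‖∂ₖ∂ₖs(τ)‖₂ ≤ σ(τ)` then `‖∂ₖ∂ₖθ(t)‖₂ ≤ ‖∂ₖ∂ₖθ(a)‖₂ + ∫ₐᵗ σ`, uniformly in `κ ≥ 0`.
[cite: MajdaBertozzi2002, §3.2 Prop. 3.7 (energy estimates for derivatives, uniform in the viscosity)] -/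
theorem stream_stream_deriv_le (hab : a < b) (h : Torus.IsClassicalScalarTransportForcedOn (Icc a b) κ u s θ)
    (hκ : 0 ≤ κ) (hu0 : ∀ t ∈ Icc a b, ∀ x, Torus.partialDeriv k (u t) x = 0)
    {σ : ℝ → ℝ} (hσc : ContinuousOn σ (Icc a b)) (hσ0 : ∀ τ ∈ Icc a b, 0 ≤ σ τ)
    (hσ : ∀ τ ∈ Icc a b,
      Real.sqrt (∫ x, (Torus.partialDeriv k (Torus.partialDeriv k (s τ)) x) ^ 2) ≤ σ τ)
    {t : ℝ} (ht : t ∈ Icc a b) :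
    Real.sqrt (∫ x, (Torus.partialDeriv k (Torus.partialDeriv k (θ t)) x) ^ 2) ≤
      Real.sqrt (∫ x, (Torus.partialDeriv k (Torus.partialDeriv k (θ a)) x) ^ 2) + ∫ τ in a..t, σ τ := by
  have h2 := (h.partialDeriv hab k).partialDeriv hab k
  refine h2.sqrt_integral_sq_le hκ Subset.rfl hσc hσ0 (fun τ hτ => ?_) ht
  -- the first-order source is `∂ₖs` as a function, so the second-order source is `∂ₖ∂ₖs`
  have e1 : (fun x => Torus.partialDeriv k (s τ) x -
      ⟪Torus.partialDeriv k (u τ) x, Torus.gradient (θ τ) x⟫_ℝ) = Torus.partialDeriv k (s τ) :=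
    funext fun x => source_stream_eq (hu0 τ hτ) x
  have e : (∫ x, (Torus.partialDeriv k (fun y => Torus.partialDeriv k (s τ) y -
      ⟪Torus.partialDeriv k (u τ) y, Torus.gradient (θ τ) y⟫_ℝ) x -
      ⟪Torus.partialDeriv k (u τ) x, Torus.gradient (Torus.partialDeriv k (θ τ)) x⟫_ℝ) ^ 2) =
      ∫ x, (Torus.partialDeriv k (Torus.partialDeriv k (s τ)) x) ^ 2 := by
    congr 1; funext x; rw [e1, hu0 τ hτ x, inner_zero_left, sub_zero]
  rw [e]
  exact hσ τ hτ

/-- **Level 2, mixed: the shear converts `∂ₖ∂ₖθ` into `∂ₖ∂ₖ'θ` at rate `α`.** With `∂ₖu = 0` and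
`|⟪∂ₖ'u(τ,x), w⟫| ≤ α(τ)|wₖ|`: if `‖∂ₖ∂ₖ's(τ)‖₂ ≤ σ(τ)` and `‖∂ₖ∂ₖθ(τ)‖₂ ≤ B` on the window, then
`‖∂ₖ∂ₖ'θ(t)‖₂ ≤ ‖∂ₖ∂ₖ'θ(a)‖₂ + ∫ₐᵗ (σ + αB)` (the second commutator `⟪∂ₖ∂ₖ'u, ∇θ⟫` vanishes since
`∂ₖ∂ₖ'u = ∂ₖ'∂ₖu = 0`), uniformly in `κ ≥ 0`.
[cite: MajdaBertozzi2002, §3.2 Prop. 3.7 (energy estimates for derivatives, uniform in the viscosity)] -/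
theorem stream_cross_deriv_le (hab : a < b) (h : Torus.IsClassicalScalarTransportForcedOn (Icc a b) κ u s θ)
    (hκ : 0 ≤ κ) (hu0 : ∀ t ∈ Icc a b, ∀ x, Torus.partialDeriv k (u t) x = 0)
    (hu1 : ∀ t ∈ Icc a b, ∀ x (w : EuclideanSpace ℝ d), |⟪Torus.partialDeriv k' (u t) x, w⟫_ℝ| ≤ α t * |w k|)
    (hαc : ContinuousOn α (Icc a b)) (hα0 : ∀ τ ∈ Icc a b, 0 ≤ α τ)
    {σ : ℝ → ℝ} (hσc : ContinuousOn σ (Icc a b)) (hσ0 : ∀ τ ∈ Icc a b, 0 ≤ σ τ)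
    (hσ : ∀ τ ∈ Icc a b,
      Real.sqrt (∫ x, (Torus.partialDeriv k (Torus.partialDeriv k' (s τ)) x) ^ 2) ≤ σ τ)
    {B : ℝ} (hB0 : 0 ≤ B)
    (hB : ∀ τ ∈ Icc a b, Real.sqrt (∫ x, (Torus.partialDeriv k (Torus.partialDeriv k (θ τ)) x) ^ 2) ≤ B)
    {t : ℝ} (ht : t ∈ Icc a b) :
    Real.sqrt (∫ x, (Torus.partialDeriv k (Torus.partialDeriv k' (θ t)) x) ^ 2) ≤
      Real.sqrt (∫ x, (Torus.partialDeriv k (Torus.partialDeriv k' (θ a)) x) ^ 2) +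
        ∫ τ in a..t, (σ τ + α τ * B) := by
  have h2 := (h.partialDeriv hab k').partialDeriv hab k
  have hGc : ContinuousOn (fun τ => σ τ + α τ * B) (Icc a b) := hσc.add (hαc.mul continuousOn_const)
  refine h2.sqrt_integral_sq_le hκ Subset.rfl (G := fun τ => σ τ + α τ * B) hGc
    (fun τ hτ => add_nonneg (hσ0 τ hτ) (mul_nonneg (hα0 τ hτ) hB0)) (fun τ hτ => ?_) ht
  show _ ≤ σ τ + α τ * B
  have hsτ : IsSmooth (s τ) := h.smooth_source.isSmooth_slice hτ
  have huτ : IsSmooth (u τ) := h.smooth_velocity.isSmooth_slice hτ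
  have hθτ : IsSmooth (θ τ) := h.smooth_scalar.isSmooth_slice hτ
  -- `∂ₖ∂ₖ'u = 0`
  have hukk' : ∀ x, Torus.partialDeriv k (Torus.partialDeriv k' (u τ)) x = 0 := by
    intro x
    rw [Torus.partialDeriv_comm huτ k k' x]
    have e0 : Torus.partialDeriv k (u τ) = fun _ => (0 : EuclideanSpace ℝ d) := funext (hu0 τ hτ)
    rw [e0]
    simp [Torus.partialDeriv, Torus.lineDeriv]
  -- the source, expanded
  have e : (∫ x, (Torus.partialDeriv k (fun y => Torus.partialDeriv k' (s τ) y -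
      ⟪Torus.partialDeriv k' (u τ) y, Torus.gradient (θ τ) y⟫_ℝ) x -
      ⟪Torus.partialDeriv k (u τ) x, Torus.gradient (Torus.partialDeriv k' (θ τ)) x⟫_ℝ) ^ 2) =
      ∫ x, (Torus.partialDeriv k (Torus.partialDeriv k' (s τ)) x -
        ⟪Torus.partialDeriv k' (u τ) x, Torus.gradient (Torus.partialDeriv k (θ τ)) x⟫_ℝ) ^ 2 := by
    congr 1; funext x
    rw [partialDeriv_source_expand hθτ hsτ huτ k k' x, hukk' x, hu0 τ hτ x, inner_zero_left,
      inner_zero_left, add_zero, sub_zero]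
  rw [e]
  have c1 : Continuous (Torus.partialDeriv k (Torus.partialDeriv k' (s τ))) :=
    ((hsτ.partialDeriv k').partialDeriv k).continuous
  have hθk : IsSmooth (Torus.partialDeriv k (θ τ)) := hθτ.partialDeriv k
  have c2 : Continuous fun x => ⟪Torus.partialDeriv k' (u τ) x, Torus.gradient (Torus.partialDeriv k (θ τ)) x⟫_ℝ :=
    (huτ.partialDeriv k').continuous.inner hθk.gradient.continuous
  have c3 : Continuous (Torus.partialDeriv k (Torus.partialDeriv k (θ τ))) := (hθk.partialDeriv k).continuous
  have i1 := sqrt_integral_sub_sq_le' c1 c2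
  have i2 : Real.sqrt (∫ x, ⟪Torus.partialDeriv k' (u τ) x, Torus.gradient (Torus.partialDeriv k (θ τ)) x⟫_ℝ ^ 2) ≤
      α τ * Real.sqrt (∫ x, (Torus.partialDeriv k (Torus.partialDeriv k (θ τ)) x) ^ 2) :=
    sqrt_integral_sq_le_mul c2 c3 (hα0 τ hτ) (abs_inner_gradient_le_of_shear hθk (hu1 τ hτ))
  have i3 := mul_le_mul_of_nonneg_left (hB τ hτ) (hα0 τ hτ)
  linarith [hσ τ hτ]

/-- **Level 2, cross–cross: two shear terms.** With `|⟪∂ₖ'u, w⟫| ≤ α|wₖ|` and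
`|⟪∂ₖ'∂ₖ'u, w⟫| ≤ β|wₖ|`: if `‖∂ₖ'∂ₖ's(τ)‖₂ ≤ σ(τ)`, `‖∂ₖθ(τ)‖₂ ≤ B` and `‖∂ₖ∂ₖ'θ(τ)‖₂ ≤ M(τ)`
(`M ≥ 0` continuous) on the window, then
`‖∂ₖ'∂ₖ'θ(t)‖₂ ≤ ‖∂ₖ'∂ₖ'θ(a)‖₂ + ∫ₐᵗ (σ + βB + 2αM)` — the source of the twice-differentiated
equation is `∂ₖ'∂ₖ's − ⟪∂ₖ'∂ₖ'u, ∇θ⟫ − 2⟪∂ₖ'u, ∇∂ₖ'θ⟫`; uniformly in `κ ≥ 0`.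
[cite: MajdaBertozzi2002, §3.2 Prop. 3.7 (energy estimates for derivatives, uniform in the viscosity)] -/
theorem cross_cross_deriv_le (hab : a < b) (h : Torus.IsClassicalScalarTransportForcedOn (Icc a b) κ u s θ)
    (hκ : 0 ≤ κ)
    (hu1 : ∀ t ∈ Icc a b, ∀ x (w : EuclideanSpace ℝ d), |⟪Torus.partialDeriv k' (u t) x, w⟫_ℝ| ≤ α t * |w k|)
    (hu2 : ∀ t ∈ Icc a b, ∀ x (w : EuclideanSpace ℝ d),
      |⟪Torus.partialDeriv k' (Torus.partialDeriv k' (u t)) x, w⟫_ℝ| ≤ β t * |w k|)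
    (hαc : ContinuousOn α (Icc a b)) (hα0 : ∀ τ ∈ Icc a b, 0 ≤ α τ)
    (hβc : ContinuousOn β (Icc a b)) (hβ0 : ∀ τ ∈ Icc a b, 0 ≤ β τ)
    {σ : ℝ → ℝ} (hσc : ContinuousOn σ (Icc a b)) (hσ0 : ∀ τ ∈ Icc a b, 0 ≤ σ τ)
    (hσ : ∀ τ ∈ Icc a b,
      Real.sqrt (∫ x, (Torus.partialDeriv k' (Torus.partialDeriv k' (s τ)) x) ^ 2) ≤ σ τ)
    {B : ℝ} (hB0 : 0 ≤ B)
    (hB : ∀ τ ∈ Icc a b, Real.sqrt (∫ x, (Torus.partialDeriv k (θ τ) x) ^ 2) ≤ B)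
    {M : ℝ → ℝ} (hMc : ContinuousOn M (Icc a b)) (hM0 : ∀ τ ∈ Icc a b, 0 ≤ M τ)
    (hM : ∀ τ ∈ Icc a b,
      Real.sqrt (∫ x, (Torus.partialDeriv k (Torus.partialDeriv k' (θ τ)) x) ^ 2) ≤ M τ)
    {t : ℝ} (ht : t ∈ Icc a b) :
    Real.sqrt (∫ x, (Torus.partialDeriv k' (Torus.partialDeriv k' (θ t)) x) ^ 2) ≤
      Real.sqrt (∫ x, (Torus.partialDeriv k' (Torus.partialDeriv k' (θ a)) x) ^ 2) +
        ∫ τ in a..t, (σ τ + β τ * B + 2 * (α τ * M τ)) := by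
  have h2 := (h.partialDeriv hab k').partialDeriv hab k'
  have hGc : ContinuousOn (fun τ => σ τ + β τ * B + 2 * (α τ * M τ)) (Icc a b) :=
    (hσc.add (hβc.mul continuousOn_const)).add (continuousOn_const.mul (hαc.mul hMc))
  refine h2.sqrt_integral_sq_le hκ Subset.rfl (G := fun τ => σ τ + β τ * B + 2 * (α τ * M τ)) hGc
    (fun τ hτ => add_nonneg (add_nonneg (hσ0 τ hτ) (mul_nonneg (hβ0 τ hτ) hB0))
      (mul_nonneg zero_le_two (mul_nonneg (hα0 τ hτ) (hM0 τ hτ)))) (fun τ hτ => ?_) ht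
  show _ ≤ σ τ + β τ * B + 2 * (α τ * M τ)
  have hsτ : IsSmooth (s τ) := h.smooth_source.isSmooth_slice hτ
  have huτ : IsSmooth (u τ) := h.smooth_velocity.isSmooth_slice hτ
  have hθτ : IsSmooth (θ τ) := h.smooth_scalar.isSmooth_slice hτ
  have hθk' : IsSmooth (Torus.partialDeriv k' (θ τ)) := hθτ.partialDeriv k'
  -- the source, expanded: `∂ₖ'∂ₖ's − (⟪∂ₖ'u, ∇∂ₖ'θ⟫ + ⟪∂ₖ'∂ₖ'u, ∇θ⟫) − ⟪∂ₖ'u, ∇∂ₖ'θ⟫`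
  have e : (∫ x, (Torus.partialDeriv k' (fun y => Torus.partialDeriv k' (s τ) y -
      ⟪Torus.partialDeriv k' (u τ) y, Torus.gradient (θ τ) y⟫_ℝ) x -
      ⟪Torus.partialDeriv k' (u τ) x, Torus.gradient (Torus.partialDeriv k' (θ τ)) x⟫_ℝ) ^ 2) =
      ∫ x, (Torus.partialDeriv k' (Torus.partialDeriv k' (s τ)) x -
        ⟪Torus.partialDeriv k' (Torus.partialDeriv k' (u τ)) x, Torus.gradient (θ τ) x⟫_ℝ -
        (2 : ℝ) * ⟪Torus.partialDeriv k' (u τ) x, Torus.gradient (Torus.partialDeriv k' (θ τ)) x⟫_ℝ) ^ 2 := by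
    congr 1; funext x
    rw [partialDeriv_source_expand hθτ hsτ huτ k' k' x]
    ring
  rw [e]
  have c1 : Continuous (Torus.partialDeriv k' (Torus.partialDeriv k' (s τ))) :=
    ((hsτ.partialDeriv k').partialDeriv k').continuous
  have c2 : Continuous fun x => ⟪Torus.partialDeriv k' (Torus.partialDeriv k' (u τ)) x, Torus.gradient (θ τ) x⟫_ℝ :=
    ((huτ.partialDeriv k').partialDeriv k').continuous.inner hθτ.gradient.continuous
  have c3 : Continuous fun x =>
      (2 : ℝ) * ⟪Torus.partialDeriv k' (u τ) x, Torus.gradient (Torus.partialDeriv k' (θ τ)) x⟫_ℝ :=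
    continuous_const.mul ((huτ.partialDeriv k').continuous.inner hθk'.gradient.continuous)
  have c4 : Continuous (Torus.partialDeriv k (θ τ)) := (hθτ.partialDeriv k).continuous
  have c5 : Continuous (Torus.partialDeriv k (Torus.partialDeriv k' (θ τ))) := (hθk'.partialDeriv k).continuous
  have i1 := sqrt_integral_sub_sub_sq_le c1 c2 c3
  have i2 : Real.sqrt (∫ x, ⟪Torus.partialDeriv k' (Torus.partialDeriv k' (u τ)) x, Torus.gradient (θ τ) x⟫_ℝ ^ 2) ≤
      β τ * Real.sqrt (∫ x, (Torus.partialDeriv k (θ τ) x) ^ 2) :=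
    sqrt_integral_sq_le_mul c2 c4 (hβ0 τ hτ) (abs_inner_gradient_le_of_shear hθτ (hu2 τ hτ))
  have i3 : Real.sqrt (∫ x, ((2 : ℝ) * ⟪Torus.partialDeriv k' (u τ) x,
        Torus.gradient (Torus.partialDeriv k' (θ τ)) x⟫_ℝ) ^ 2) ≤
      (2 * α τ) * Real.sqrt (∫ x, (Torus.partialDeriv k (Torus.partialDeriv k' (θ τ)) x) ^ 2) := by
    refine sqrt_integral_sq_le_mul c3 c5 (mul_nonneg zero_le_two (hα0 τ hτ)) fun x => ?_
    have h1 := abs_inner_gradient_le_of_shear hθk' (hu1 τ hτ) x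
    rw [abs_mul, abs_two, mul_assoc]
    exact mul_le_mul_of_nonneg_left h1 zero_le_two
  have i4 := mul_le_mul_of_nonneg_left (hB τ hτ) (hβ0 τ hτ)
  have i5 := mul_le_mul_of_nonneg_left (hM τ hτ) (mul_nonneg zero_le_two (hα0 τ hτ))
  have hσ' := hσ τ hτ
  nlinarith [i1, i2, i3, i4, i5, hσ', Real.sqrt_nonneg (∫ x, (Torus.partialDeriv k (θ τ) x) ^ 2)]

end Growth


end Summit.AnomalousDissipation.AnomalousDissipation.Theorems.SawtoothPulseCascade.LipAgmon

end
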